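import Mathlib
import Literature.Analysis.ODE.SchrodingerODE
import Literature.Analysis.ODE.VariationOfParametersTail
import Literature.Analysis.ODE.PowerScaleAsymptotics
import HarnessLib

/-!
# Right inverses of `−∂² + V` on a right half-line by variation of parameters, with power bounds

Analysis/ODE support file (everything proved, no definitions). Let `V` be continuous and let
`u₀, u₁` be global classical solutions of `u'' = V u` (`IsSchrodingerSol`) with Wronskian
`u₀ u₁' − u₀' u₁ ≡ 1` and power bounds on `[x₁, ∞)` (`x₁ ≥ 1`, `ℓ : ℕ`):
`|u₀| ≤ A₀ x^{-ℓ}`, `|u₀'| ≤ A₀ x^{-ℓ-1}`, `|u₁| ≤ A₁ x^{ℓ+1}`, `|u₁'| ≤ A₁ x^{ℓ}` (real powers).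
For a continuous source `f` with `|f(y)| ≤ B y^q` on `[x₁, ∞)` the variation-of-parameters formulas

  `g = u₁ ∫_x^∞ u₀ f + u₀ ∫_{x₁}^x u₁ f`      (`−ℓ−2 < q < ℓ−1`, `exists_sourcedSol_rpow_mid`),
  `g = u₁ ∫_x^∞ u₀ f − u₀ ∫_x^∞ u₁ f`        (`q < −ℓ−2`, `exists_sourcedSol_rpow_top`)

define global `C²` solutions of `−g'' + V g = f` (i.e. `(g')' = V g − f`) with
`|g| ≤ K B x^{q+2}`, `|g'| ≤ K B x^{q+1}` on `[x₁, ∞)`, where `K` depends only on `A₀, A₁, ℓ, q`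
(and is fixed BEFORE `f`). Standard (e.g. P. Hartman, *Ordinary Differential Equations*, Ch. XI;
folklore). Use: the descending coefficient chain of the true t-polynomial far kernel of the
Regge–Wheeler channel estimate `FixedModeChannels` (route PhotonSphereChannels,
stmt-FinalStateConjecture-10048).
-/

noncomputable section

namespace Literature.Analysis.ODE

open MeasureTheory Set Filter Topology intervalIntegral

/-! ### Calculus helpers for tail integrals -/

/-- A continuous function integrable on `(a, ∞)` is integrable on every `(x, ∞)`. [folklore] -/
theorem integrableOn_Ioi_of_integrableOn_Ioi {k : ℝ → ℝ} (hk : Continuous k) {a : ℝ}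
    (hki : IntegrableOn k (Ioi a)) (x : ℝ) : IntegrableOn k (Ioi x) := by
  rcases le_or_gt a x with hx | hx
  · exact hki.mono_set (Ioi_subset_Ioi hx)
  · have : Ioi x = Ioc x a ∪ Ioi a := (Ioc_union_Ioi_eq_Ioi hx.le).symm
    rw [this]
    exact (hk.integrableOn_Icc.mono_set Ioc_subset_Icc_self).union hki

/-- Fundamental theorem of calculus for tails: `d/dx ∫_x^∞ k = −k(x)` for continuous `k` integrable
on every right half-line. [folklore] -/
theorem hasDerivAt_setIntegral_Ioi {k : ℝ → ℝ} (hk : Continuous k)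
    (hki : ∀ x, IntegrableOn k (Ioi x)) (x : ℝ) :
    HasDerivAt (fun z => ∫ y in Ioi z, k y) (-k x) x := by
  have hev : (fun z => ∫ y in Ioi z, k y) = fun z => (∫ y in Ioi (x - 1), k y) - ∫ y in (x - 1)..z, k y := by
    funext z
    have := intervalIntegral.integral_Ioi_sub_Ioi' (hki (x - 1)) (hki z)
    linarith
  rw [hev]
  have h := (intervalIntegral.integral_hasDerivAt_right (hk.intervalIntegrable (x - 1) x)
    (hk.stronglyMeasurableAtFilter volume (𝓝 x)) hk.continuousAt).const_sub (∫ y in Ioi (x - 1), k y)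
  simpa using h

/-- Tail bound: if `|k y| ≤ M y^p` on `[x₁, ∞)` with `p < −1`, `x₁ ≥ 1`, then for `x ≥ x₁`,
`k` is integrable on `(x, ∞)` and `|∫_x^∞ k| ≤ M x^{p+1} / (−p−1)`. [folklore] -/
theorem abs_setIntegral_Ioi_le_of_le_rpow {k : ℝ → ℝ} (hk : Continuous k) {x₁ M p : ℝ}
    (hx₁ : 1 ≤ x₁) (hp : p < -1) (hb : ∀ y, x₁ ≤ y → |k y| ≤ M * y ^ p) {x : ℝ} (hx : x₁ ≤ x) :
    IntegrableOn k (Ioi x) ∧ |∫ y in Ioi x, k y| ≤ M * x ^ (p + 1) / (-p - 1) := by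
  have hx0 : 0 < x := by linarith
  have hbi : IntegrableOn (fun y => M * y ^ p) (Ioi x) :=
    (integrableOn_Ioi_rpow_of_lt hp hx0).const_mul M
  have hbd : ∀ y ∈ Ioi x, |k y| ≤ M * y ^ p := fun y hy => hb y (hx.trans (le_of_lt hy))
  have hi : IntegrableOn k (Ioi x) :=
    Integrable.mono' hbi hk.aestronglyMeasurable ((ae_restrict_iff' measurableSet_Ioi).2
      (Eventually.of_forall fun y hy => by rw [Real.norm_eq_abs]; exact hbd y hy))
  refine ⟨hi, ?_⟩
  have hp1 : p + 1 ≠ 0 := by linarith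
  calc |∫ y in Ioi x, k y| ≤ ∫ y in Ioi x, |k y| := abs_integral_le_integral_abs
    _ ≤ ∫ y in Ioi x, M * y ^ p := setIntegral_mono_on hi.abs hbi measurableSet_Ioi hbd
    _ = M * (-x ^ (p + 1) / (p + 1)) := by
        rw [MeasureTheory.integral_const_mul, integral_Ioi_rpow_of_lt hp hx0]
    _ = M * x ^ (p + 1) / (-p - 1) := by
        have : (-p - 1) ≠ 0 := by linarith
        field_simp
        ring

/-- Interval bound: if `|k y| ≤ M y^p` on `[x₁, ∞)` with `−1 < p`, `x₁ ≥ 1`, then for `x ≥ x₁`,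
`|∫_{x₁}^x k| ≤ M x^{p+1} / (p+1)`. [folklore] -/
theorem abs_intervalIntegral_le_of_le_rpow {k : ℝ → ℝ} (hk : Continuous k) {x₁ M p : ℝ}
    (hx₁ : 1 ≤ x₁) (hp : -1 < p) (hb : ∀ y, x₁ ≤ y → |k y| ≤ M * y ^ p) {x : ℝ} (hx : x₁ ≤ x) :
    |∫ y in x₁..x, k y| ≤ M * x ^ (p + 1) / (p + 1) := by
  have hM : 0 ≤ M := by
    have h := hb x₁ le_rfl
    have hp' : 0 < x₁ ^ p := Real.rpow_pos_of_pos (by linarith) _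
    nlinarith [abs_nonneg (k x₁)]
  have hp1 : 0 < p + 1 := by linarith
  calc |∫ y in x₁..x, k y| ≤ ∫ y in x₁..x, |k y| :=
        intervalIntegral.abs_integral_le_integral_abs hx
    _ ≤ ∫ y in x₁..x, M * y ^ p := by
        refine intervalIntegral.integral_mono_on hx (hk.abs.intervalIntegrable _ _) ?_
          fun y hy => hb y hy.1
        have hcont : ContinuousOn (fun y : ℝ => M * y ^ p) (uIcc x₁ x) := by
          refine continuousOn_const.mul (continuousOn_id.rpow_const fun y hy => Or.inl ?_)
          rw [uIcc_of_le hx] at hy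
          have : x₁ ≤ y := hy.1
          show y ≠ 0
          exact ne_of_gt (by linarith)
        exact hcont.intervalIntegrable
    _ = M * ((x ^ (p + 1) - x₁ ^ (p + 1)) / (p + 1)) := by
        rw [intervalIntegral.integral_const_mul, integral_rpow (Or.inl hp)]
    _ ≤ M * x ^ (p + 1) / (p + 1) := by
        have h0 : 0 ≤ x₁ ^ (p + 1) := Real.rpow_nonneg (by linarith) _
        have : (x ^ (p + 1) - x₁ ^ (p + 1)) / (p + 1) ≤ x ^ (p + 1) / (p + 1) :=
          div_le_div_of_nonneg_right (by linarith) hp1.le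
        calc M * ((x ^ (p + 1) - x₁ ^ (p + 1)) / (p + 1)) ≤ M * (x ^ (p + 1) / (p + 1)) :=
              mul_le_mul_of_nonneg_left this hM
          _ = M * x ^ (p + 1) / (p + 1) := by ring

/-! ### Variation of parameters with a source -/

section VarParams

variable {V u₀ u₁ : ℝ → ℝ}

/-- **Core.** If `u₀, u₁` solve `u'' = Vu` with Wronskian `1`, and `α' = u₁ f`, `β' = −u₀ f`, then
`g = u₀ α + u₁ β` is `C²` with `g' = u₀' α + u₁' β` and `(g')' = V g − f`. [folklore] -/
theorem sourcedSol_varParams (hV : Continuous V) (hu₀ : IsSchrodingerSol V u₀)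
    (hu₁ : IsSchrodingerSol V u₁) (hw : ∀ x, u₀ x * deriv u₁ x - deriv u₀ x * u₁ x = 1)
    {α β f : ℝ → ℝ} (hf : Continuous f) (hα : ∀ x, HasDerivAt α (u₁ x * f x) x)
    (hβ : ∀ x, HasDerivAt β (-(u₀ x * f x)) x) :
    ContDiff ℝ 2 (fun x => u₀ x * α x + u₁ x * β x) ∧
      (∀ x, deriv (fun x => u₀ x * α x + u₁ x * β x) x = deriv u₀ x * α x + deriv u₁ x * β x) ∧
      ∀ x, HasDerivAt (deriv fun x => u₀ x * α x + u₁ x * β x)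
        (V x * (u₀ x * α x + u₁ x * β x) - f x) x := by
  set g : ℝ → ℝ := fun x => u₀ x * α x + u₁ x * β x with hg
  set D : ℝ → ℝ := fun x => deriv u₀ x * α x + deriv u₁ x * β x with hD
  have hgd : ∀ x, HasDerivAt g (D x) x := fun x =>
    hasDerivAt_varParams (κ := 1) (h := fun y => -f y) (hu₀.differentiable x) (hu₁.differentiable x)
      ((hα x).congr_deriv (by ring)) ((hβ x).congr_deriv (by ring))
  have hderiv : deriv g = D := funext fun x => (hgd x).deriv
  have hDd : ∀ x, HasDerivAt D (V x * g x - f x) x := fun x => by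
    have h := hasDerivAt_varParams_deriv (κ := 1) (h := fun y => -f y) (q := V x)
      (hu₀.hasDerivAt_deriv x) (hu₁.hasDerivAt_deriv x)
      ((hα x).congr_deriv (by ring)) ((hβ x).congr_deriv (by ring)) (by rw [one_mul]; exact hw x)
    exact h.congr_deriv (by simp only [hg]; ring)
  have hαc : Continuous α := continuous_iff_continuousAt.2 fun x => (hα x).continuousAt
  have hβc : Continuous β := continuous_iff_continuousAt.2 fun x => (hβ x).continuousAt
  have hgc : Continuous g := (hu₀.continuous.mul hαc).add (hu₁.continuous.mul hβc)
  refine ⟨?_, fun x => by rw [hderiv], fun x => by rw [hderiv]; exact hDd x⟩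
  -- `C²`: `g' = D` is differentiable with continuous derivative `V g − f`
  have hD1 : ContDiff ℝ 1 D := by
    rw [show (1 : WithTop ℕ∞) = 0 + 1 by norm_num, contDiff_succ_iff_deriv]
    refine ⟨fun x => (hDd x).differentiableAt, fun h => absurd h (by simp), ?_⟩
    have : deriv D = fun x => V x * g x - f x := funext fun x => (hDd x).deriv
    rw [this]
    exact contDiff_zero.2 ((hV.mul hgc).sub hf)
  rw [show (2 : WithTop ℕ∞) = 1 + 1 by norm_num, contDiff_succ_iff_deriv]
  exact ⟨fun x => (hgd x).differentiableAt, fun h => absurd h (by simp), by rw [hderiv]; exact hD1⟩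

/-- **Sourced solution with power bounds, middle range `−ℓ−2 < q < ℓ−1`.** See the module
docstring (`g = u₁ ∫_x^∞ u₀ f + u₀ ∫_{x₁}^x u₁ f`). [folklore] -/
theorem exists_sourcedSol_rpow_mid (hV : Continuous V) (hu₀ : IsSchrodingerSol V u₀)
    (hu₁ : IsSchrodingerSol V u₁) (hw : ∀ x, u₀ x * deriv u₁ x - deriv u₀ x * u₁ x = 1)
    {x₁ A₀ A₁ : ℝ} (hx₁ : 1 ≤ x₁) (ℓ : ℕ)
    (b₀ : ∀ x, x₁ ≤ x → |u₀ x| ≤ A₀ * x ^ (-(ℓ : ℝ)))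
    (b₀' : ∀ x, x₁ ≤ x → |deriv u₀ x| ≤ A₀ * x ^ (-(ℓ : ℝ) - 1))
    (b₁ : ∀ x, x₁ ≤ x → |u₁ x| ≤ A₁ * x ^ ((ℓ : ℝ) + 1))
    (b₁' : ∀ x, x₁ ≤ x → |deriv u₁ x| ≤ A₁ * x ^ (ℓ : ℝ))
    {q : ℝ} (hq₁ : -(ℓ : ℝ) - 2 < q) (hq₂ : q < (ℓ : ℝ) - 1)
    {f : ℝ → ℝ} (hf : Continuous f) {B : ℝ} (hfB : ∀ y, x₁ ≤ y → |f y| ≤ B * y ^ q) :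
    ∃ g : ℝ → ℝ, ContDiff ℝ 2 g ∧ (∀ x, HasDerivAt (deriv g) (V x * g x - f x) x) ∧
      ∀ x, x₁ ≤ x →
        |g x| ≤ A₀ * A₁ * (1 / (ℓ - q - 1) + 1 / (q + ℓ + 2)) * B * x ^ (q + 2) ∧
        |deriv g x| ≤ A₀ * A₁ * (1 / (ℓ - q - 1) + 1 / (q + ℓ + 2)) * B * x ^ (q + 1) := by
  have hx₁0 : 0 < x₁ := by linarith
  have hA₀ : 0 ≤ A₀ := nonneg_of_abs_le_mul_rpow hx₁0 (b₀ x₁ le_rfl)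
  have hA₁ : 0 ≤ A₁ := nonneg_of_abs_le_mul_rpow hx₁0 (b₁ x₁ le_rfl)
  have hB : 0 ≤ B := nonneg_of_abs_le_mul_rpow hx₁0 (hfB x₁ le_rfl)
  have hd₁ : 0 < (ℓ : ℝ) - q - 1 := by linarith
  have hd₂ : 0 < q + ℓ + 2 := by linarith
  -- the two kernels and their power bounds
  set k₀ : ℝ → ℝ := fun y => u₀ y * f y with hk₀
  set k₁ : ℝ → ℝ := fun y => u₁ y * f y with hk₁
  have hk₀c : Continuous k₀ := hu₀.continuous.mul hf
  have hk₁c : Continuous k₁ := hu₁.continuous.mul hf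
  have hk₀b : ∀ y, x₁ ≤ y → |k₀ y| ≤ A₀ * B * y ^ (q - ℓ) := by
    intro y hy
    have hy0 : 0 < y := by linarith
    rw [hk₀, abs_mul, show q - ℓ = -(ℓ : ℝ) + q by ring, Real.rpow_add hy0]
    calc |u₀ y| * |f y| ≤ (A₀ * y ^ (-(ℓ : ℝ))) * (B * y ^ q) :=
          mul_le_mul (b₀ y hy) (hfB y hy) (abs_nonneg _) (by positivity)
      _ = A₀ * B * (y ^ (-(ℓ : ℝ)) * y ^ q) := by ring
  have hk₁b : ∀ y, x₁ ≤ y → |k₁ y| ≤ A₁ * B * y ^ (q + ℓ + 1) := by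
    intro y hy
    have hy0 : 0 < y := by linarith
    rw [hk₁, abs_mul, show q + ℓ + 1 = ((ℓ : ℝ) + 1) + q by ring, Real.rpow_add hy0]
    calc |u₁ y| * |f y| ≤ (A₁ * y ^ ((ℓ : ℝ) + 1)) * (B * y ^ q) :=
          mul_le_mul (b₁ y hy) (hfB y hy) (abs_nonneg _) (by positivity)
      _ = A₁ * B * (y ^ ((ℓ : ℝ) + 1) * y ^ q) := by ring
  -- tail of `k₀` and primitive of `k₁`
  have hP : ∀ x, x₁ ≤ x → IntegrableOn k₀ (Ioi x) ∧
      |∫ y in Ioi x, k₀ y| ≤ A₀ * B * x ^ (q - ℓ + 1) / (-(q - ℓ) - 1) := fun x hx =>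
    abs_setIntegral_Ioi_le_of_le_rpow hk₀c hx₁ (by linarith) hk₀b hx
  have hk₀i : ∀ x, IntegrableOn k₀ (Ioi x) :=
    integrableOn_Ioi_of_integrableOn_Ioi hk₀c (hP x₁ le_rfl).1
  set P : ℝ → ℝ := fun x => ∫ y in Ioi x, k₀ y with hPdef
  set Q : ℝ → ℝ := fun x => ∫ y in x₁..x, k₁ y with hQdef
  have hPd : ∀ x, HasDerivAt P (-(u₀ x * f x)) x := fun x => hasDerivAt_setIntegral_Ioi hk₀c hk₀i x
  have hQd : ∀ x, HasDerivAt Q (u₁ x * f x) x := fun x =>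
    intervalIntegral.integral_hasDerivAt_right (hk₁c.intervalIntegrable _ _)
      (hk₁c.stronglyMeasurableAtFilter volume (𝓝 x)) hk₁c.continuousAt
  have hQb : ∀ x, x₁ ≤ x → |Q x| ≤ A₁ * B * x ^ (q + ℓ + 1 + 1) / (q + ℓ + 1 + 1) := fun x hx =>
    abs_intervalIntegral_le_of_le_rpow hk₁c hx₁ (by linarith) hk₁b hx
  -- the solution
  obtain ⟨hC2, hder, hsol⟩ := sourcedSol_varParams hV hu₀ hu₁ hw hf hQd hPd
  refine ⟨fun x => u₀ x * Q x + u₁ x * P x, hC2, hsol, fun x hx => ?_⟩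
  have hx0 : 0 < x := by linarith
  have hPx := (hP x hx).2
  have hQx := hQb x hx
  have e1 : -(q - (ℓ : ℝ)) - 1 = ℓ - q - 1 := by ring
  have e2 : q + (ℓ : ℝ) + 1 + 1 = q + ℓ + 2 := by ring
  rw [e1] at hPx
  rw [e2] at hQx
  -- products of powers
  have p1 : x ^ (-(ℓ : ℝ)) * x ^ (q + ℓ + 2) = x ^ (q + 2) := by
    rw [← Real.rpow_add hx0]; congr 1; ring
  have p2 : x ^ ((ℓ : ℝ) + 1) * x ^ (q - ℓ + 1) = x ^ (q + 2) := by
    rw [← Real.rpow_add hx0]; congr 1; ring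
  have p3 : x ^ (-(ℓ : ℝ) - 1) * x ^ (q + ℓ + 2) = x ^ (q + 1) := by
    rw [← Real.rpow_add hx0]; congr 1; ring
  have p4 : x ^ (ℓ : ℝ) * x ^ (q - ℓ + 1) = x ^ (q + 1) := by
    rw [← Real.rpow_add hx0]; congr 1; ring
  have hPn : 0 ≤ A₀ * B * x ^ (q - ℓ + 1) / (ℓ - q - 1) := by positivity
  have hQn : 0 ≤ A₁ * B * x ^ (q + ℓ + 2) / (q + ℓ + 2) := by positivity
  constructor
  · calc |u₀ x * Q x + u₁ x * P x| ≤ |u₀ x| * |Q x| + |u₁ x| * |P x| := by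
          refine (abs_add_le _ _).trans ?_; rw [abs_mul, abs_mul]
      _ ≤ (A₀ * x ^ (-(ℓ : ℝ))) * (A₁ * B * x ^ (q + ℓ + 2) / (q + ℓ + 2))
          + (A₁ * x ^ ((ℓ : ℝ) + 1)) * (A₀ * B * x ^ (q - ℓ + 1) / (ℓ - q - 1)) :=
          add_le_add (mul_le_mul (b₀ x hx) hQx (abs_nonneg _) (by positivity))
            (mul_le_mul (b₁ x hx) hPx (abs_nonneg _) (by positivity))
      _ = A₀ * A₁ * B * (x ^ (-(ℓ : ℝ)) * x ^ (q + ℓ + 2)) / (q + ℓ + 2)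
          + A₀ * A₁ * B * (x ^ ((ℓ : ℝ) + 1) * x ^ (q - ℓ + 1)) / (ℓ - q - 1) := by ring
      _ = A₀ * A₁ * (1 / (ℓ - q - 1) + 1 / (q + ℓ + 2)) * B * x ^ (q + 2) := by
          rw [p1, p2]; ring
  · rw [hder x]
    calc |deriv u₀ x * Q x + deriv u₁ x * P x|
        ≤ |deriv u₀ x| * |Q x| + |deriv u₁ x| * |P x| := by
          refine (abs_add_le _ _).trans ?_; rw [abs_mul, abs_mul]
      _ ≤ (A₀ * x ^ (-(ℓ : ℝ) - 1)) * (A₁ * B * x ^ (q + ℓ + 2) / (q + ℓ + 2))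
          + (A₁ * x ^ (ℓ : ℝ)) * (A₀ * B * x ^ (q - ℓ + 1) / (ℓ - q - 1)) :=
          add_le_add (mul_le_mul (b₀' x hx) hQx (abs_nonneg _) (by positivity))
            (mul_le_mul (b₁' x hx) hPx (abs_nonneg _) (by positivity))
      _ = A₀ * A₁ * B * (x ^ (-(ℓ : ℝ) - 1) * x ^ (q + ℓ + 2)) / (q + ℓ + 2)
          + A₀ * A₁ * B * (x ^ (ℓ : ℝ) * x ^ (q - ℓ + 1)) / (ℓ - q - 1) := by ring
      _ = A₀ * A₁ * (1 / (ℓ - q - 1) + 1 / (q + ℓ + 2)) * B * x ^ (q + 1) := by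
          rw [p3, p4]; ring

/-- **Sourced solution with power bounds, top range `q < −ℓ−2`.** See the module docstring
(`g = u₁ ∫_x^∞ u₀ f − u₀ ∫_x^∞ u₁ f`, both tails convergent). [folklore] -/
theorem exists_sourcedSol_rpow_top (hV : Continuous V) (hu₀ : IsSchrodingerSol V u₀)
    (hu₁ : IsSchrodingerSol V u₁) (hw : ∀ x, u₀ x * deriv u₁ x - deriv u₀ x * u₁ x = 1)
    {x₁ A₀ A₁ : ℝ} (hx₁ : 1 ≤ x₁) (ℓ : ℕ)
    (b₀ : ∀ x, x₁ ≤ x → |u₀ x| ≤ A₀ * x ^ (-(ℓ : ℝ)))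
    (b₀' : ∀ x, x₁ ≤ x → |deriv u₀ x| ≤ A₀ * x ^ (-(ℓ : ℝ) - 1))
    (b₁ : ∀ x, x₁ ≤ x → |u₁ x| ≤ A₁ * x ^ ((ℓ : ℝ) + 1))
    (b₁' : ∀ x, x₁ ≤ x → |deriv u₁ x| ≤ A₁ * x ^ (ℓ : ℝ))
    {q : ℝ} (hq : q < -(ℓ : ℝ) - 2)
    {f : ℝ → ℝ} (hf : Continuous f) {B : ℝ} (hfB : ∀ y, x₁ ≤ y → |f y| ≤ B * y ^ q) :
    ∃ g : ℝ → ℝ, ContDiff ℝ 2 g ∧ (∀ x, HasDerivAt (deriv g) (V x * g x - f x) x) ∧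
      ∀ x, x₁ ≤ x →
        |g x| ≤ A₀ * A₁ * (1 / (ℓ - q - 1) + 1 / (-q - ℓ - 2)) * B * x ^ (q + 2) ∧
        |deriv g x| ≤ A₀ * A₁ * (1 / (ℓ - q - 1) + 1 / (-q - ℓ - 2)) * B * x ^ (q + 1) := by
  have hx₁0 : 0 < x₁ := by linarith
  have hA₀ : 0 ≤ A₀ := nonneg_of_abs_le_mul_rpow hx₁0 (b₀ x₁ le_rfl)
  have hA₁ : 0 ≤ A₁ := nonneg_of_abs_le_mul_rpow hx₁0 (b₁ x₁ le_rfl)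
  have hB : 0 ≤ B := nonneg_of_abs_le_mul_rpow hx₁0 (hfB x₁ le_rfl)
  have hℓ0 : (0 : ℝ) ≤ ℓ := Nat.cast_nonneg ℓ
  have hd₁ : 0 < (ℓ : ℝ) - q - 1 := by linarith
  have hd₂ : 0 < -q - ℓ - 2 := by linarith
  set k₀ : ℝ → ℝ := fun y => u₀ y * f y with hk₀
  set k₁ : ℝ → ℝ := fun y => u₁ y * f y with hk₁
  have hk₀c : Continuous k₀ := hu₀.continuous.mul hf
  have hk₁c : Continuous k₁ := hu₁.continuous.mul hf
  have hk₀b : ∀ y, x₁ ≤ y → |k₀ y| ≤ A₀ * B * y ^ (q - ℓ) := by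
    intro y hy
    have hy0 : 0 < y := by linarith
    rw [hk₀, abs_mul, show q - ℓ = -(ℓ : ℝ) + q by ring, Real.rpow_add hy0]
    calc |u₀ y| * |f y| ≤ (A₀ * y ^ (-(ℓ : ℝ))) * (B * y ^ q) :=
          mul_le_mul (b₀ y hy) (hfB y hy) (abs_nonneg _) (by positivity)
      _ = A₀ * B * (y ^ (-(ℓ : ℝ)) * y ^ q) := by ring
  have hk₁b : ∀ y, x₁ ≤ y → |k₁ y| ≤ A₁ * B * y ^ (q + ℓ + 1) := by
    intro y hy
    have hy0 : 0 < y := by linarith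
    rw [hk₁, abs_mul, show q + ℓ + 1 = ((ℓ : ℝ) + 1) + q by ring, Real.rpow_add hy0]
    calc |u₁ y| * |f y| ≤ (A₁ * y ^ ((ℓ : ℝ) + 1)) * (B * y ^ q) :=
          mul_le_mul (b₁ y hy) (hfB y hy) (abs_nonneg _) (by positivity)
      _ = A₁ * B * (y ^ ((ℓ : ℝ) + 1) * y ^ q) := by ring
  have hP : ∀ x, x₁ ≤ x → IntegrableOn k₀ (Ioi x) ∧
      |∫ y in Ioi x, k₀ y| ≤ A₀ * B * x ^ (q - ℓ + 1) / (-(q - ℓ) - 1) := fun x hx =>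
    abs_setIntegral_Ioi_le_of_le_rpow hk₀c hx₁ (by linarith) hk₀b hx
  have hPt : ∀ x, x₁ ≤ x → IntegrableOn k₁ (Ioi x) ∧
      |∫ y in Ioi x, k₁ y| ≤ A₁ * B * x ^ (q + ℓ + 1 + 1) / (-(q + ℓ + 1) - 1) := fun x hx =>
    abs_setIntegral_Ioi_le_of_le_rpow hk₁c hx₁ (by linarith) hk₁b hx
  have hk₀i : ∀ x, IntegrableOn k₀ (Ioi x) :=
    integrableOn_Ioi_of_integrableOn_Ioi hk₀c (hP x₁ le_rfl).1
  have hk₁i : ∀ x, IntegrableOn k₁ (Ioi x) :=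
    integrableOn_Ioi_of_integrableOn_Ioi hk₁c (hPt x₁ le_rfl).1
  set P : ℝ → ℝ := fun x => ∫ y in Ioi x, k₀ y with hPdef
  set α : ℝ → ℝ := fun x => -∫ y in Ioi x, k₁ y with hαdef
  have hPd : ∀ x, HasDerivAt P (-(u₀ x * f x)) x := fun x => hasDerivAt_setIntegral_Ioi hk₀c hk₀i x
  have hαd : ∀ x, HasDerivAt α (u₁ x * f x) x := fun x => by
    have h := (hasDerivAt_setIntegral_Ioi hk₁c hk₁i x).neg
    simp only [neg_neg] at h
    exact h.congr_of_eventuallyEq (Eventually.of_forall fun z => rfl)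
  obtain ⟨hC2, hder, hsol⟩ := sourcedSol_varParams hV hu₀ hu₁ hw hf hαd hPd
  refine ⟨fun x => u₀ x * α x + u₁ x * P x, hC2, hsol, fun x hx => ?_⟩
  have hx0 : 0 < x := by linarith
  have hPx := (hP x hx).2
  have hαx : |α x| ≤ A₁ * B * x ^ (q + ℓ + 2) / (-q - ℓ - 2) := by
    have h := (hPt x hx).2
    rw [show q + (ℓ : ℝ) + 1 + 1 = q + ℓ + 2 by ring, show -(q + (ℓ : ℝ) + 1) - 1 = -q - ℓ - 2 by ring]
      at h
    simpa only [hαdef, abs_neg] using h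
  have e1 : -(q - (ℓ : ℝ)) - 1 = ℓ - q - 1 := by ring
  rw [e1] at hPx
  have p1 : x ^ (-(ℓ : ℝ)) * x ^ (q + ℓ + 2) = x ^ (q + 2) := by
    rw [← Real.rpow_add hx0]; congr 1; ring
  have p2 : x ^ ((ℓ : ℝ) + 1) * x ^ (q - ℓ + 1) = x ^ (q + 2) := by
    rw [← Real.rpow_add hx0]; congr 1; ring
  have p3 : x ^ (-(ℓ : ℝ) - 1) * x ^ (q + ℓ + 2) = x ^ (q + 1) := by
    rw [← Real.rpow_add hx0]; congr 1; ring
  have p4 : x ^ (ℓ : ℝ) * x ^ (q - ℓ + 1) = x ^ (q + 1) := by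
    rw [← Real.rpow_add hx0]; congr 1; ring
  have hPn : 0 ≤ A₀ * B * x ^ (q - ℓ + 1) / (ℓ - q - 1) := by positivity
  have hαn : 0 ≤ A₁ * B * x ^ (q + ℓ + 2) / (-q - ℓ - 2) := by positivity
  constructor
  · calc |u₀ x * α x + u₁ x * P x| ≤ |u₀ x| * |α x| + |u₁ x| * |P x| := by
          refine (abs_add_le _ _).trans ?_; rw [abs_mul, abs_mul]
      _ ≤ (A₀ * x ^ (-(ℓ : ℝ))) * (A₁ * B * x ^ (q + ℓ + 2) / (-q - ℓ - 2))
          + (A₁ * x ^ ((ℓ : ℝ) + 1)) * (A₀ * B * x ^ (q - ℓ + 1) / (ℓ - q - 1)) :=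
          add_le_add (mul_le_mul (b₀ x hx) hαx (abs_nonneg _) (by positivity))
            (mul_le_mul (b₁ x hx) hPx (abs_nonneg _) (by positivity))
      _ = A₀ * A₁ * B * (x ^ (-(ℓ : ℝ)) * x ^ (q + ℓ + 2)) / (-q - ℓ - 2)
          + A₀ * A₁ * B * (x ^ ((ℓ : ℝ) + 1) * x ^ (q - ℓ + 1)) / (ℓ - q - 1) := by ring
      _ = A₀ * A₁ * (1 / (ℓ - q - 1) + 1 / (-q - ℓ - 2)) * B * x ^ (q + 2) := by
          rw [p1, p2]; ring
  · rw [hder x]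
    calc |deriv u₀ x * α x + deriv u₁ x * P x|
        ≤ |deriv u₀ x| * |α x| + |deriv u₁ x| * |P x| := by
          refine (abs_add_le _ _).trans ?_; rw [abs_mul, abs_mul]
      _ ≤ (A₀ * x ^ (-(ℓ : ℝ) - 1)) * (A₁ * B * x ^ (q + ℓ + 2) / (-q - ℓ - 2))
          + (A₁ * x ^ (ℓ : ℝ)) * (A₀ * B * x ^ (q - ℓ + 1) / (ℓ - q - 1)) :=
          add_le_add (mul_le_mul (b₀' x hx) hαx (abs_nonneg _) (by positivity))
            (mul_le_mul (b₁' x hx) hPx (abs_nonneg _) (by positivity))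
      _ = A₀ * A₁ * B * (x ^ (-(ℓ : ℝ) - 1) * x ^ (q + ℓ + 2)) / (-q - ℓ - 2)
          + A₀ * A₁ * B * (x ^ (ℓ : ℝ) * x ^ (q - ℓ + 1)) / (ℓ - q - 1) := by ring
      _ = A₀ * A₁ * (1 / (ℓ - q - 1) + 1 / (-q - ℓ - 2)) * B * x ^ (q + 1) := by
          rw [p3, p4]; ring

end VarParams

end Literature.Analysis.ODE
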